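import Mathlib
import HarnessLib

/-!
# Restarted primal–dual methods converge linearly on sharp problems
# (Applegate–Hinder–Lu–Lubin, *Math. Program.* 201 (2023) 133–184, Theorem 1)

Topic `Literature/Analysis/Convex` (companion of `PrimalDualHybridGradient.lean`, which proves for the
Chambolle–Pock / PDHG kernel on a constrained bilinear saddle exactly the two ingredients the paper
feeds into its restart scheme: the one-step "sufficient decay" inequality
`L(x⁺, y) − L(x, y⁺) ≤ ½‖z − zᵗ‖²_M − ½‖z − zᵗ⁺¹‖²_M` = [ApplegateEtAl2022, Property 1 for PDHG]
(`PrimalDualHybridGradient.conicL_step_le`) and its consequences, Fejér non-expansiveness and the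
ergodic `O(1/t)` gap bound = [ApplegateEtAl2022, Proposition 2] (`fejer_step`, `conicL_gap_ergodic_le`)).

This file records, in the generality in which it is PRINTED, the restart theorem itself:
[ApplegateEtAl2022, §4, Theorem 1 (Fixed frequency restarts)]. The paper's standing objects are a
primal–dual problem on `Z` with solution set `Z*`, a "carefully selected semi-norm" `‖·‖` on `Z`
(for PDHG the `M`-seminorm), the normalized duality gap `ρ_r(z)` [ApplegateEtAl2022, §1 (4)], and a
base algorithm whose averaged output after `t` inner iterations started at `z⁰` we write `T z⁰`
(= `z̄^{t}`; a restart feeds `T z⁰` back in, so the restarted sequence is `z^{n,0} = T^[n] z^{0,0}`).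
Theorem 1 is stated and proved in the paper from exactly two abstract hypotheses —
[ApplegateEtAl2022, Property 3] on the algorithm and `α`-sharpness [ApplegateEtAl2022, Definition 1]
of the problem on a ball — by a half-page induction; we type those two hypotheses as predicates on an
abstract gap function `ρ : ℝ → Z → ℝ` over a pseudo-metric space `Z` (a semi-norm induces a
pseudo-metric; `dist(z, Z*)` is `Metric.infDist`) and prove the theorem as printed:
`dist(z^{n,0}, Z*) ≤ βⁿ · dist(z^{0,0}, Z*)` whenever the restart length `t` satisfies
`2C(q + 2)/(α t) ≤ β` (the paper's `t ≥ t* := ⌈2C(q+2)/(αβ)⌉`).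

* `IsGapSharpOn ρ Zstar S α` — Definition 1: `α · dist(z, Z*) ≤ ρ_r(z)` for `z ∈ S` and
  `0 ≤ r ≤ diam S`. The paper writes `r ∈ (0, diam S]` and separately sets
  `ρ_0(z) := limsup_{r→0⁺} ρ_r(z)` [§1, footnote to (4)], under which the inequality persists at
  `r = 0` ([ApplegateEtAl2022, proof of Proposition 5: "which immediately implies the result also holds
  for r = 0"]); we therefore take the closed range, which is what the proof of Theorem 1 uses in the
  degenerate case `‖z^{N+1,0} − z^{N,0}‖ = 0` (their Proposition 8).
* `RestartProperty ρ Zstar T C q t` — Property 3 for the restart map `T`: (a)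
  `ρ_{‖z̄ − z⁰‖}(z̄) ≤ 2C‖z̄ − z⁰‖/t` and (b) `‖z̄ − z⁰‖ ≤ (q + 2) dist(z⁰, Z*)`, `z̄ = T z⁰`.
* `dist_iterate_start_le` — the first display of the proof: the restarted iterates stay in the ball
  of radius `R = (q+2)/(1−β) · dist(z^{0,0}, Z*)`.
* **`infDist_iterate_le_pow`** — Theorem 1.

* Section "Adaptive restarts" = [ApplegateEtAl2022, Theorem 2]: `adaptive_condition_of_le` (the adaptive
  criterion `ρ_{‖z̄ − z^{n,0}‖}(z̄) ≤ β ρ_{‖z^{n,0} − z^{n−1,0}‖}(z^{n,0})` is met at every inner length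
  `t₁` with `2C(q+2)/(αt₁) ≤ β`), `adaptive_length_le` (= Thm 2 (i): `τ_n ≤ t*` for the first-hit
  scheme), **`infDist_adaptive_le`** (= Thm 2 (ii): `dist(z^{n+1,0}, Z*) ≤ βⁿ (2C(q+2)/(ατ₀)) dist(z^{0,0}, Z*)`),
  all relative to `α`-sharpness on a bounded set containing the restart points.

* Section "Sharpness with slack" = [XiongFreund2024, Theorem 3.5] (Z. Xiong, R. M. Freund, *The role
  of level-set geometry on the performance of PDHG for conic linear optimization*, arXiv:2406.01942
  (2024), §3.2, pp. 18–20, read at the page): the adaptive scheme needs sharpness only UP TO A SLACK —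
  if `dist(z^{n,0}, Z*) ≤ L · ρ_{‖z^{n,0} − z^{n−1,0}‖}(z^{n,0}) + C'` at the restart points (their
  (3.19)), then the first-hit inner lengths obey `τ_n ≤ 1 + 2C(q+2)(L + C'/g_{n−1})/β`
  (`adaptive_condition_of_slack`, `adaptive_length_le_of_slack`; `g_k` the restart potentials), and
  the total inner-iteration count spent before the first potential `≤ ε` is
  `Σ_{n<N} τ_n ≤ τ_0 + (N − 1)(1 + 2C(q+2)L/β) + 2C(q+2)C'/(β ε (1−β))` with
  `(N − 2) log(1/β) < log(2C(q+2) dist(z^{0,0}, Z*)/(τ_0 ε))` (**`sum_adaptive_lengths_le_of_slack`**,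
  `restart_count_lt_of_potentials_gt`; the pure bookkeeping is `sum_inv_potential_le` = (3.29) and
  `sum_lengths_le` = (3.28)–(3.30)) — the printed `T ≤ 23L·ln(23 dist(z^{0,0}, Z*)/ε) + 35C/ε` for
  `β = 1/e` and the paper's Property-3 constant `8`: LINEAR convergence down to the scale `C'` and
  `O(C'/ε)` below it. This is the form in which the restart analysis reaches general CONIC programs
  (SDP included): there `C' > 0` comes from the geometry of the primal–dual sublevel sets
  [XiongFreund2024, Lemma 3.13 / Theorem 3.3], while genuine sharpness (`C' = 0`) can fail
  (`SemidefiniteSharpnessFailure.lean`). Typed abstractly over Property 3 (the paper states it for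
  restarted PDHG, whose Property-3 constants are its Lemma 2.4; the proof uses nothing else); the PDHG
  instance is in `RestartedPDHG.lean`.

Deliberately NOT here (each is a separate printed statement): that PPM/EGM/PDHG/ADMM satisfy
Property 3 with the constants of [ApplegateEtAl2022, Table 1] (Propositions 1, 3, 4 — the PDHG row is
typed concretely in `RestartedPDHG.lean`), that LP is sharp (Lemma 5, via Hoffman's bound — the bound
itself is `HoffmanErrorBound.lean`) and the lower bounds of §5. Nothing in print makes a spectrahedral
(SDP) saddle sharp; the theorems are silent there.
-/

namespace Literature.Analysis.Convex.PrimalDualRestartSharpness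

open Metric

variable {Z : Type*} [PseudoMetricSpace Z]

/-- **Sharpness of a primal–dual problem on a set** [ApplegateEtAl2022, Definition 1], abstract in the
normalized duality gap `ρ r z = ρ_r(z)`: the problem with solution set `Zstar` is `α`-sharp on `S` when
`α · dist(z, Z*) ≤ ρ_r(z)` for every `z ∈ S` and every radius `0 ≤ r ≤ diam S` (closed at `0` by the
paper's convention `ρ_0 = limsup_{r→0⁺} ρ_r`, see the module docstring).
[cite: ApplegateEtAl2022, Definition 1 and §1 (4) with its footnote] -/
def IsGapSharpOn (ρ : ℝ → Z → ℝ) (Zstar S : Set Z) (α : ℝ) : Prop :=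
  ∀ z ∈ S, ∀ r : ℝ, 0 ≤ r → r ≤ diam S → α * infDist z Zstar ≤ ρ r z

/-- **Property 3** of [ApplegateEtAl2022] for the restart map `T` (`T z⁰ = z̄^{t}`, the averaged
output of `t` inner iterations started at `z⁰`), with constants `C, q` and inner length `t`:
(a) `ρ_{‖z̄^t − z⁰‖}(z̄^t) ≤ 2C‖z̄^t − z⁰‖ / t`; (b) `‖z̄^t − z⁰‖ ≤ (q + 2) · dist(z⁰, Z*)`.
[cite: ApplegateEtAl2022, Property 3] -/
structure RestartProperty (ρ : ℝ → Z → ℝ) (Zstar : Set Z) (T : Z → Z) (C q t : ℝ) : Prop where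
  /-- (a) the `O(1/t)` decay of the normalized duality gap at the natural radius. -/
  gap_le : ∀ z₀ : Z, ρ (dist (T z₀) z₀) (T z₀) ≤ 2 * C * dist (T z₀) z₀ / t
  /-- (b) the output does not move far from the start. -/
  dist_le : ∀ z₀ : Z, dist (T z₀) z₀ ≤ (q + 2) * infDist z₀ Zstar

/-- Unfolding lemma for `IsGapSharpOn`. [cite: ApplegateEtAl2022, Definition 1] -/
theorem isGapSharpOn_def (ρ : ℝ → Z → ℝ) (Zstar S : Set Z) (α : ℝ) :
    IsGapSharpOn ρ Zstar S α ↔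
      ∀ z ∈ S, ∀ r : ℝ, 0 ≤ r → r ≤ diam S → α * infDist z Zstar ≤ ρ r z := Iff.rfl

/-- A smaller constant keeps sharpness (immediate from the definition; cf. the monotonicity remarks
after [ApplegateEtAl2022, Definition 1]). [cite: ApplegateEtAl2022, Definition 1] -/
theorem IsGapSharpOn.mono_const {ρ : ℝ → Z → ℝ} {Zstar S : Set Z} {α α' : ℝ}
    (h : IsGapSharpOn ρ Zstar S α) (hα' : α' ≤ α) : IsGapSharpOn ρ Zstar S α' :=
  fun z hz r hr0 hr =>
    (mul_le_mul_of_nonneg_right hα' infDist_nonneg).trans (h z hz r hr0 hr)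

/-- Partial geometric sums stay below `(1 − β)⁻¹` for `0 ≤ β < 1`. [folklore] -/
private theorem geom_sum_le_inv {β : ℝ} (hβ0 : 0 ≤ β) (hβ1 : β < 1) (m : ℕ) :
    ∑ k ∈ Finset.range m, β ^ k ≤ (1 - β)⁻¹ := by
  have h1 : 0 < 1 - β := by linarith
  have hsum : (∑ k ∈ Finset.range m, β ^ k) * (1 - β) = 1 - β ^ m := by
    have := geom_sum_mul_neg β m
    linarith [this]
  have hm : 0 ≤ β ^ m := pow_nonneg hβ0 m
  rw [inv_eq_one_div, le_div_iff₀ h1]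
  nlinarith [hsum, hm]

/-- The first display in the proof of [ApplegateEtAl2022, Thm 1]: as long as the distances to `Z*`
contract geometrically up to step `N`, every restarted iterate `z^{m,0}`, `m ≤ N + 1`, lies within
`R = (q + 2)/(1 − β) · dist(z^{0,0}, Z*)` of the start (triangle inequality + Property 3 (b) +
geometric series). [cite: ApplegateEtAl2022, Theorem 1 (proof, first display)] -/
theorem dist_iterate_start_le {ρ : ℝ → Z → ℝ} {Zstar : Set Z} {T : Z → Z} {C q t β : ℝ}
    (hT : RestartProperty ρ Zstar T C q t) (hq : 0 ≤ q + 2) (hβ0 : 0 ≤ β) (hβ1 : β < 1) (z₀ : Z)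
    {N : ℕ} (hN : ∀ n ≤ N, infDist (T^[n] z₀) Zstar ≤ β ^ n * infDist z₀ Zstar) {m : ℕ}
    (hm : m ≤ N + 1) :
    dist (T^[m] z₀) z₀ ≤ (q + 2) / (1 - β) * infDist z₀ Zstar := by
  have h1 : 0 < 1 - β := by linarith
  have hd0 : 0 ≤ infDist z₀ Zstar := infDist_nonneg
  -- triangle inequality along the restarts
  have htri : dist (T^[m] z₀) z₀ ≤ ∑ k ∈ Finset.range m, dist (T^[k + 1] z₀) (T^[k] z₀) := by
    rw [dist_comm]
    have h := dist_le_range_sum_dist (fun k => T^[k] z₀) m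
    refine h.trans (le_of_eq (Finset.sum_congr rfl fun k _ => dist_comm _ _))
  -- each restart moves by at most `(q+2) dist(z^{k,0}, Z*) ≤ (q+2) β^k dist(z^{0,0}, Z*)`
  have hstep : ∀ k ∈ Finset.range m,
      dist (T^[k + 1] z₀) (T^[k] z₀) ≤ (q + 2) * (β ^ k * infDist z₀ Zstar) := by
    intro k hk
    have hkN : k ≤ N := by
      have := Finset.mem_range.mp hk
      omega
    rw [Function.iterate_succ_apply']
    exact (hT.dist_le _).trans (mul_le_mul_of_nonneg_left (hN k hkN) hq)
  calc dist (T^[m] z₀) z₀ ≤ ∑ k ∈ Finset.range m, dist (T^[k + 1] z₀) (T^[k] z₀) := htri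
    _ ≤ ∑ k ∈ Finset.range m, (q + 2) * (β ^ k * infDist z₀ Zstar) := Finset.sum_le_sum hstep
    _ = (q + 2) * infDist z₀ Zstar * ∑ k ∈ Finset.range m, β ^ k := by
        rw [Finset.mul_sum]
        exact Finset.sum_congr rfl fun k _ => by ring
    _ ≤ (q + 2) * infDist z₀ Zstar * (1 - β)⁻¹ :=
        mul_le_mul_of_nonneg_left (geom_sum_le_inv hβ0 hβ1 m) (mul_nonneg hq hd0)
    _ = (q + 2) / (1 - β) * infDist z₀ Zstar := by
        rw [div_eq_mul_inv]; ring

/-- **Restarted primal–dual methods converge linearly on sharp problems**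
[ApplegateEtAl2022, Theorem 1 (Fixed frequency restarts)]. Let the base algorithm's restart map `T`
(inner length `t > 0`) satisfy Property 3 with constants `C, q` (in print `q, C > 0`; the proof uses
only `C ≥ 0`, `q + 2 ≥ 0`),
let `0 ≤ β < 1`, let the restart length satisfy `2C(q + 2)/(α t) ≤ β` (i.e. `t ≥ t*`), and let the
problem be `α`-sharp (`α > 0`) on the ball `W_R(z^{0,0})`, `R = (q + 2)/(1 − β) · dist(z^{0,0}, Z*)`.
Then the restarted sequence `z^{n,0} = T^[n] z^{0,0}` satisfies
`dist(z^{n,0}, Z*) ≤ βⁿ · dist(z^{0,0}, Z*)` for every `n`.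
Proof as printed: induction; the iterates stay in the ball (`dist_iterate_start_le`); sharpness at
`z^{N+1,0}` with `r = ‖z^{N+1,0} − z^{N,0}‖`, Property 3 (a), Property 3 (b), the choice of `t`.
[cite: ApplegateEtAl2022, Theorem 1] -/
theorem infDist_iterate_le_pow {ρ : ℝ → Z → ℝ} {Zstar : Set Z} {T : Z → Z} {C q t α β : ℝ}
    (hT : RestartProperty ρ Zstar T C q t) (hC : 0 ≤ C) (hq : 0 ≤ q + 2) (ht : 0 < t)
    (hα : 0 < α) (hβ0 : 0 ≤ β) (hβ1 : β < 1) (htstar : 2 * C * (q + 2) / (α * t) ≤ β) (z₀ : Z)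
    (hsharp : IsGapSharpOn ρ Zstar (closedBall z₀ ((q + 2) / (1 - β) * infDist z₀ Zstar)) α)
    (n : ℕ) : infDist (T^[n] z₀) Zstar ≤ β ^ n * infDist z₀ Zstar := by
  set R := (q + 2) / (1 - β) * infDist z₀ Zstar with hR
  have hd0 : 0 ≤ infDist z₀ Zstar := infDist_nonneg
  -- strong induction, packaged as a statement about all `n ≤ N`
  suffices hall : ∀ N, ∀ n ≤ N, infDist (T^[n] z₀) Zstar ≤ β ^ n * infDist z₀ Zstar from
    hall n n le_rfl
  intro N
  induction N with
  | zero =>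
      intro n hn
      rw [Nat.le_zero.mp hn]
      simp
  | succ N ih =>
      intro n hn
      rcases Nat.lt_or_eq_of_le hn with hlt | rfl
      · exact ih n (Nat.lt_succ_iff.mp hlt)
      -- the new case `n = N + 1`
      have hmem1 : T^[N + 1] z₀ ∈ closedBall z₀ R :=
        mem_closedBall.mpr (dist_iterate_start_le hT hq hβ0 hβ1 z₀ ih le_rfl)
      have hmem0 : T^[N] z₀ ∈ closedBall z₀ R :=
        mem_closedBall.mpr (dist_iterate_start_le hT hq hβ0 hβ1 z₀ ih (Nat.le_succ N))
      set r := dist (T^[N + 1] z₀) (T^[N] z₀) with hr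
      have hr0 : 0 ≤ r := dist_nonneg
      have hrdiam : r ≤ diam (closedBall z₀ R) := dist_le_diam_of_mem isBounded_closedBall hmem1 hmem0
      -- sharpness at `z^{N+1,0}` with radius `r`
      have h1 : α * infDist (T^[N + 1] z₀) Zstar ≤ ρ r (T^[N + 1] z₀) :=
        hsharp _ hmem1 r hr0 hrdiam
      -- Property 3 (a) for the start `z^{N,0}`
      have h2 : ρ r (T^[N + 1] z₀) ≤ 2 * C * r / t := by
        have h := hT.gap_le (T^[N] z₀)
        rw [← Function.iterate_succ_apply' T N z₀] at h
        exact h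
      -- Property 3 (b) and the induction hypothesis
      have h3 : r ≤ (q + 2) * (β ^ N * infDist z₀ Zstar) := by
        have h := hT.dist_le (T^[N] z₀)
        rw [← Function.iterate_succ_apply' T N z₀] at h
        exact h.trans (mul_le_mul_of_nonneg_left (ih N le_rfl) hq)
      -- assemble
      have h4 : α * infDist (T^[N + 1] z₀) Zstar ≤
          2 * C * (q + 2) / (α * t) * (α * (β ^ N * infDist z₀ Zstar)) := by
        have h23 : 2 * C * r / t ≤ 2 * C * ((q + 2) * (β ^ N * infDist z₀ Zstar)) / t :=
          div_le_div_of_nonneg_right (mul_le_mul_of_nonneg_left h3 (by positivity)) ht.le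
        refine (h1.trans (h2.trans h23)).trans (le_of_eq ?_)
        field_simp
      have hβN : 0 ≤ α * (β ^ N * infDist z₀ Zstar) := by positivity
      have h5 : α * infDist (T^[N + 1] z₀) Zstar ≤ β * (α * (β ^ N * infDist z₀ Zstar)) :=
        h4.trans (mul_le_mul_of_nonneg_right htstar hβN)
      have h6 : infDist (T^[N + 1] z₀) Zstar ≤ β * (β ^ N * infDist z₀ Zstar) := by
        have : α * infDist (T^[N + 1] z₀) Zstar ≤ α * (β * (β ^ N * infDist z₀ Zstar)) := by
          linarith
        exact le_of_mul_le_mul_left this hα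
      calc infDist (T^[N + 1] z₀) Zstar ≤ β * (β ^ N * infDist z₀ Zstar) := h6
        _ = β ^ (N + 1) * infDist z₀ Zstar := by ring

/-- The iteration-count reading [ApplegateEtAl2022, Remark 3 after Thm 1]: to reach
`dist(z^{n,0}, Z*) ≤ ε` it suffices that `βⁿ · dist(z^{0,0}, Z*) ≤ ε`. [cite: ApplegateEtAl2022, Theorem 1 and the Remark following it] -/
theorem infDist_iterate_le_of_pow_le {ρ : ℝ → Z → ℝ} {Zstar : Set Z} {T : Z → Z}
    {C q t α β : ℝ} (hT : RestartProperty ρ Zstar T C q t) (hC : 0 ≤ C) (hq : 0 ≤ q + 2)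
    (ht : 0 < t) (hα : 0 < α) (hβ0 : 0 ≤ β) (hβ1 : β < 1) (htstar : 2 * C * (q + 2) / (α * t) ≤ β)
    (z₀ : Z)
    (hsharp : IsGapSharpOn ρ Zstar (closedBall z₀ ((q + 2) / (1 - β) * infDist z₀ Zstar)) α)
    {ε : ℝ} {n : ℕ} (hn : β ^ n * infDist z₀ Zstar ≤ ε) : infDist (T^[n] z₀) Zstar ≤ ε :=
  (infDist_iterate_le_pow hT hC hq ht hα hβ0 hβ1 htstar z₀ hsharp n).trans hn

/-! ### Adaptive restarts ([ApplegateEtAl2022, §4, Theorem 2]) -/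

/-- **The adaptive restart criterion is met by time `t*`** — the content of [ApplegateEtAl2022,
Thm 2 (i)] ("the restart length `τ_n` is upper bounded by `t*`"): if every inner length `t ≥ 1` has
Property 3 (constants `C ≥ 0`, `q + 2 ≥ 0`), the problem is `α`-sharp on a bounded set `S` containing
the two last restart points `z^{n−1,0}`, `z^{n,0}`, and `t₁ ≥ 1` satisfies `2C(q + 2)/(α t₁) ≤ β`, then
the adaptive restart condition `ρ_{‖z̄ − z^{n,0}‖}(z̄) ≤ β · ρ_{‖z^{n,0} − z^{n−1,0}‖}(z^{n,0})` HOLDS for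
`z̄ = T_{t₁} z^{n,0}`; hence a scheme restarting at the first inner step where the condition holds has
`τ_n ≤ t₁` (`adaptive_length_le`). Proof as printed: Property 3 (i), sharpness at `z^{n,0}` with
`r = ‖z^{n,0} − z^{n−1,0}‖`, Property 3 (ii), the choice of `t₁` (arranged multiplicatively, so no
division by `dist(z^{n,0}, Z*)` is needed). [cite: ApplegateEtAl2022, Theorem 2 (i) (proof)] -/
theorem adaptive_condition_of_le {ρ : ℝ → Z → ℝ} {Zstar S : Set Z} {T : ℕ → Z → Z} {C q α β : ℝ}
    (hT : ∀ t : ℕ, 1 ≤ t → RestartProperty ρ Zstar (T t) C q t) (hC : 0 ≤ C) (hq : 0 ≤ q + 2)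
    (hα : 0 < α) (hS : Bornology.IsBounded S) (hsharp : IsGapSharpOn ρ Zstar S α) {zprev zn : Z}
    (hprev : zprev ∈ S) (hn : zn ∈ S) {t₁ : ℕ} (ht₁ : 1 ≤ t₁)
    (htstar : 2 * C * (q + 2) / (α * t₁) ≤ β) :
    ρ (dist (T t₁ zn) zn) (T t₁ zn) ≤ β * ρ (dist zn zprev) zn := by
  have ht₁' : (0 : ℝ) < t₁ := Nat.cast_pos.mpr ht₁
  set r := dist zn zprev with hr
  -- sharpness at `z^{n,0}` with radius `r`
  have hsh : α * infDist zn Zstar ≤ ρ r zn :=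
    hsharp zn hn r dist_nonneg (dist_le_diam_of_mem hS hn hprev)
  have hρ0 : 0 ≤ ρ r zn := le_trans (mul_nonneg hα.le infDist_nonneg) hsh
  -- Property 3 (i) and (ii) for the inner length `t₁`
  have h1 : ρ (dist (T t₁ zn) zn) (T t₁ zn) ≤ 2 * C * dist (T t₁ zn) zn / t₁ := (hT t₁ ht₁).gap_le zn
  have h2 : dist (T t₁ zn) zn ≤ (q + 2) * infDist zn Zstar := (hT t₁ ht₁).dist_le zn
  -- chain
  have h3 : 2 * C * dist (T t₁ zn) zn / t₁ ≤ 2 * C * ((q + 2) * infDist zn Zstar) / t₁ :=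
    div_le_div_of_nonneg_right (mul_le_mul_of_nonneg_left h2 (by positivity)) ht₁'.le
  have h4 : 2 * C * ((q + 2) * infDist zn Zstar) / t₁ ≤ 2 * C * (q + 2) / (α * t₁) * ρ r zn := by
    have e : 2 * C * ((q + 2) * infDist zn Zstar) / t₁ =
        2 * C * (q + 2) / (α * t₁) * (α * infDist zn Zstar) := by
      field_simp
    rw [e]
    exact mul_le_mul_of_nonneg_left hsh (by positivity)
  have h5 : 2 * C * (q + 2) / (α * t₁) * ρ r zn ≤ β * ρ r zn :=
    mul_le_mul_of_nonneg_right htstar hρ0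
  exact h1.trans (h3.trans (h4.trans h5))

/-- **[ApplegateEtAl2022, Theorem 2 (i)]: adaptive restart lengths are at most `t*`.** If the
`n`-th restart happens at the FIRST inner step `τ_n ≥ 1` at which the adaptive condition holds (the
scheme of Algorithm 1), then `τ_n ≤ t₁` for every `t₁ ≥ 1` with `2C(q+2)/(α t₁) ≤ β` — in particular
`τ_n ≤ t* = ⌈2C(q+2)/(αβ)⌉`. [cite: ApplegateEtAl2022, Theorem 2 (i)] -/
theorem adaptive_length_le {ρ : ℝ → Z → ℝ} {Zstar S : Set Z} {T : ℕ → Z → Z} {C q α β : ℝ}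
    (hT : ∀ t : ℕ, 1 ≤ t → RestartProperty ρ Zstar (T t) C q t) (hC : 0 ≤ C) (hq : 0 ≤ q + 2)
    (hα : 0 < α) (hS : Bornology.IsBounded S) (hsharp : IsGapSharpOn ρ Zstar S α) {zprev zn : Z}
    (hprev : zprev ∈ S) (hn : zn ∈ S) {τn : ℕ}
    (hfirst : ∀ t : ℕ, 1 ≤ t → t < τn →
      ¬ ρ (dist (T t zn) zn) (T t zn) ≤ β * ρ (dist zn zprev) zn)
    {t₁ : ℕ} (ht₁ : 1 ≤ t₁) (htstar : 2 * C * (q + 2) / (α * t₁) ≤ β) : τn ≤ t₁ := by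
  by_contra hlt
  push Not at hlt
  exact hfirst t₁ ht₁ hlt
    (adaptive_condition_of_le hT hC hq hα hS hsharp hprev hn ht₁ htstar)

/-- **[ApplegateEtAl2022, Theorem 2 (ii)]: linear convergence of adaptively restarted primal–dual
methods.** Let `z^{n+1,0} = T_{τ_n} z^{n,0}` with inner lengths `τ_n ≥ 1`, every `T_t` having
Property 3, and suppose the adaptive restart condition
`ρ_{‖z^{n+1,0} − z^{n,0}‖}(z^{n+1,0}) ≤ β · ρ_{‖z^{n,0} − z^{n−1,0}‖}(z^{n,0})` holds at every restart
`n ≥ 1`. If all restart points lie in a bounded set `S` on which the problem is `α`-sharp, then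
`dist(z^{n+1,0}, Z*) ≤ βⁿ · (2C(q+2)/(α τ₀)) · dist(z^{0,0}, Z*)` for every `n` — the printed
`dist(z^{n,0}, Z*) ≤ βⁿ (t*/τ₀) dist(z^{0,0}, Z*)` since `2C(q+2)/α ≤ β t*`. Proof as printed: sharpness
at `z^{n+1,0}`, the restart condition recursively, Property 3 (i) and (ii) for the first restart.
[cite: ApplegateEtAl2022, Theorem 2 (ii)] -/
theorem infDist_adaptive_le {ρ : ℝ → Z → ℝ} {Zstar S : Set Z} {T : ℕ → Z → Z} {C q α β : ℝ}
    (hT : ∀ t : ℕ, 1 ≤ t → RestartProperty ρ Zstar (T t) C q t) (hC : 0 ≤ C)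
    (hα : 0 < α) (hβ : 0 ≤ β) (hS : Bornology.IsBounded S) (hsharp : IsGapSharpOn ρ Zstar S α)
    {z : ℕ → Z} {τ : ℕ → ℕ} (hτ : ∀ n, 1 ≤ τ n) (hz : ∀ n, z (n + 1) = T (τ n) (z n))
    (hzS : ∀ n, z n ∈ S)
    (hcond : ∀ n, ρ (dist (z (n + 2)) (z (n + 1))) (z (n + 2)) ≤
      β * ρ (dist (z (n + 1)) (z n)) (z (n + 1)))
    (n : ℕ) :
    infDist (z (n + 1)) Zstar ≤
      β ^ n * (2 * C * (q + 2) / (α * τ 0)) * infDist (z 0) Zstar := by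
  -- the potentials `g k = ρ_{‖z^{k+1,0} − z^{k,0}‖}(z^{k+1,0})`
  set g : ℕ → ℝ := fun k => ρ (dist (z (k + 1)) (z k)) (z (k + 1)) with hg
  -- geometric decay of the potentials
  have hgeo : ∀ k, g k ≤ β ^ k * g 0 := by
    intro k
    induction k with
    | zero => simp
    | succ k ih =>
        calc g (k + 1) ≤ β * g k := hcond k
          _ ≤ β * (β ^ k * g 0) := mul_le_mul_of_nonneg_left ih hβ
          _ = β ^ (k + 1) * g 0 := by ring
  -- the first potential is controlled by Property 3 at `z^{0,0}`
  have hτ0 : (0 : ℝ) < τ 0 := Nat.cast_pos.mpr (hτ 0)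
  have hfirst : g 0 ≤ 2 * C * (q + 2) / τ 0 * infDist (z 0) Zstar := by
    have h1 : g 0 ≤ 2 * C * dist (z 1) (z 0) / τ 0 := by
      have h := (hT (τ 0) (hτ 0)).gap_le (z 0)
      rw [← hz 0] at h
      exact h
    have h2 : dist (z 1) (z 0) ≤ (q + 2) * infDist (z 0) Zstar := by
      have h := (hT (τ 0) (hτ 0)).dist_le (z 0)
      rw [← hz 0] at h
      exact h
    calc g 0 ≤ 2 * C * dist (z 1) (z 0) / τ 0 := h1
      _ ≤ 2 * C * ((q + 2) * infDist (z 0) Zstar) / τ 0 :=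
          div_le_div_of_nonneg_right (mul_le_mul_of_nonneg_left h2 (by positivity)) hτ0.le
      _ = 2 * C * (q + 2) / τ 0 * infDist (z 0) Zstar := by
          field_simp
  -- sharpness at `z^{n+1,0}` and assembly
  have hsh : α * infDist (z (n + 1)) Zstar ≤ g n :=
    hsharp (z (n + 1)) (hzS _) _ dist_nonneg (dist_le_diam_of_mem hS (hzS _) (hzS _))
  have hmain : α * infDist (z (n + 1)) Zstar ≤
      β ^ n * (2 * C * (q + 2) / τ 0 * infDist (z 0) Zstar) :=
    hsh.trans ((hgeo n).trans (mul_le_mul_of_nonneg_left hfirst (pow_nonneg hβ n)))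
  have e : β ^ n * (2 * C * (q + 2) / (α * τ 0)) * infDist (z 0) Zstar =
      α⁻¹ * (β ^ n * (2 * C * (q + 2) / τ 0 * infDist (z 0) Zstar)) := by
    field_simp
  rw [e, ← div_eq_inv_mul, le_div_iff₀ hα, mul_comm]
  exact hmain

/-! ### Sharpness with slack: the iteration complexity of adaptive restarts
([XiongFreund2024, Theorem 3.5]) -/

/-- Under the adaptive restart condition `g_{n+1} ≤ β g_n` the restart potentials
`g_n = ρ_{‖z^{n+1,0} − z^{n,0}‖}(z^{n+1,0})` decay geometrically: `g_{k+j} ≤ β^j g_k`.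
[cite: XiongFreund2024, Theorem 3.5 (proof, (3.25))] -/
theorem potential_add_le_pow_mul {g : ℕ → ℝ} {β : ℝ} (hβ : 0 ≤ β)
    (hcond : ∀ n, g (n + 1) ≤ β * g n) (k j : ℕ) : g (k + j) ≤ β ^ j * g k := by
  induction j with
  | zero => simp
  | succ j ih =>
      calc g (k + (j + 1)) = g (k + j + 1) := by rw [Nat.add_succ]
        _ ≤ β * g (k + j) := hcond (k + j)
        _ ≤ β * (β ^ j * g k) := mul_le_mul_of_nonneg_left ih hβ
        _ = β ^ (j + 1) * g k := by ring

/-- **The reciprocal potentials sum to at most `1/(ε(1−β))` before convergence**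
[XiongFreund2024, Theorem 3.5 (proof, (3.29))]: if `g_{n+1} ≤ β g_n` (`0 ≤ β < 1`) and
`g_k > ε > 0` for all `k < M`, then `Σ_{k<M} 1/g_k ≤ 1/(ε(1−β))` (backwards from the last
potential above `ε`: `1/g_k ≤ β^{M−1−k}/g_{M−1} < β^{M−1−k}/ε`).
[cite: XiongFreund2024, Theorem 3.5 (proof, display (3.29))] -/
theorem sum_inv_potential_le {g : ℕ → ℝ} {β ε : ℝ} (hβ0 : 0 ≤ β) (hβ1 : β < 1) (hε : 0 < ε)
    (hcond : ∀ n, g (n + 1) ≤ β * g n) {M : ℕ} (hM : ∀ k < M, ε < g k) :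
    ∑ k ∈ Finset.range M, (g k)⁻¹ ≤ (ε * (1 - β))⁻¹ := by
  rcases M.eq_zero_or_pos with rfl | hMpos
  · simp only [Finset.range_zero, Finset.sum_empty]
    exact inv_nonneg.mpr (mul_nonneg hε.le (by linarith))
  obtain ⟨M', rfl⟩ : ∃ M', M = M' + 1 := ⟨M - 1, by omega⟩
  -- each term: `(g k)⁻¹ ≤ β^(M'-k) / ε`
  have hterm : ∀ k ∈ Finset.range (M' + 1), (g k)⁻¹ ≤ β ^ (M' + 1 - 1 - k) * ε⁻¹ := by
    intro k hk
    have hkM : k ≤ M' := Nat.lt_succ_iff.mp (Finset.mem_range.mp hk)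
    have hgkpos : 0 < g k := hε.trans (hM k (Finset.mem_range.mp hk))
    have hdec : g M' ≤ β ^ (M' - k) * g k := by
      have h := potential_add_le_pow_mul hβ0 hcond k (M' - k)
      rwa [Nat.add_sub_cancel' hkM] at h
    have hgM : ε < g M' := hM M' (Nat.lt_succ_self M')
    have h1 : ε ≤ g k * β ^ (M' - k) := by
      rw [mul_comm]; exact (hgM.trans_le hdec).le
    have h2 : (g k)⁻¹ * ε ≤ β ^ (M' - k) := (inv_mul_le_iff₀ hgkpos).mpr h1
    have h3 : (g k)⁻¹ ≤ β ^ (M' - k) * ε⁻¹ := by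
      rw [← div_eq_mul_inv, le_div_iff₀ hε]; exact h2
    simpa [Nat.add_sub_cancel] using h3
  calc ∑ k ∈ Finset.range (M' + 1), (g k)⁻¹
      ≤ ∑ k ∈ Finset.range (M' + 1), β ^ (M' + 1 - 1 - k) * ε⁻¹ := Finset.sum_le_sum hterm
    _ = (∑ k ∈ Finset.range (M' + 1), β ^ (M' + 1 - 1 - k)) * ε⁻¹ := by
        rw [Finset.sum_mul]
    _ = (∑ k ∈ Finset.range (M' + 1), β ^ k) * ε⁻¹ := by
        rw [Finset.sum_range_reflect (fun k => β ^ k) (M' + 1)]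
    _ ≤ (1 - β)⁻¹ * ε⁻¹ :=
        mul_le_mul_of_nonneg_right (geom_sum_le_inv hβ0 hβ1 _) (inv_nonneg.mpr hε.le)
    _ = (ε * (1 - β))⁻¹ := by rw [mul_inv, mul_comm]

/-- **Counting core of [XiongFreund2024, Theorem 3.5]** (pure bookkeeping, displays (3.28)–(3.30)):
if the inner lengths after the first satisfy `τ_{k+1} ≤ 1 + a + b/g_k` while `g_k > ε`
(`k + 2 ≤ N`), the potentials contract (`g_{n+1} ≤ β g_n`) and stay above `ε` before restart
`N − 1`, then the total number of inner iterations up to restart `N` is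
`Σ_{n<N} τ_n ≤ τ_0 + (N − 1)(1 + a) + b/(ε(1 − β))`.
[cite: XiongFreund2024, Theorem 3.5 (proof, (3.28)–(3.30))] -/
theorem sum_lengths_le {τ : ℕ → ℕ} {g : ℕ → ℝ} {β ε a b : ℝ} (hβ0 : 0 ≤ β) (hβ1 : β < 1)
    (hε : 0 < ε) (hb : 0 ≤ b) (hcond : ∀ n, g (n + 1) ≤ β * g n) {N : ℕ}
    (hN : 1 ≤ N) (hpot : ∀ k, k + 2 ≤ N → ε < g k)
    (hlen : ∀ k, k + 2 ≤ N → (τ (k + 1) : ℝ) ≤ 1 + a + b * (g k)⁻¹) :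
    (∑ n ∈ Finset.range N, (τ n : ℝ)) ≤
      τ 0 + ((N : ℝ) - 1) * (1 + a) + b * (ε * (1 - β))⁻¹ := by
  obtain ⟨M, rfl⟩ : ∃ M, N = M + 1 := ⟨N - 1, by omega⟩
  rw [Finset.sum_range_succ']
  have hM : ((M + 1 : ℕ) : ℝ) - 1 = M := by push_cast; ring
  rw [hM]
  have hpot' : ∀ k < M, ε < g k := fun k hk => hpot k (by omega)
  have hsum1 : ∑ k ∈ Finset.range M, (τ (k + 1) : ℝ) ≤
      ∑ k ∈ Finset.range M, (1 + a + b * (g k)⁻¹) :=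
    Finset.sum_le_sum fun k hk => hlen k (by have := Finset.mem_range.mp hk; omega)
  have hsum2 : ∑ k ∈ Finset.range M, (1 + a + b * (g k)⁻¹) =
      (M : ℝ) * (1 + a) + b * ∑ k ∈ Finset.range M, (g k)⁻¹ := by
    rw [Finset.sum_add_distrib, Finset.sum_const, Finset.card_range, nsmul_eq_mul,
      Finset.mul_sum]
  have hsum3 : b * ∑ k ∈ Finset.range M, (g k)⁻¹ ≤ b * (ε * (1 - β))⁻¹ :=
    mul_le_mul_of_nonneg_left (sum_inv_potential_le hβ0 hβ1 hε hcond hpot') hb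
  linarith [hsum1, hsum2, hsum3]

/-- **The adaptive restart criterion under sharpness with slack** — the inner-loop bound of
[XiongFreund2024, Theorem 3.5 (proof, (3.21)–(3.24))], abstract over [ApplegateEtAl2022, Property 3]
(constants `C ≥ 0`, `q + 2 ≥ 0` for every inner length `t ≥ 1`): if the restart point `z^{n,0}`
satisfies the relaxed sharpness bound `dist(z^{n,0}, Z*) ≤ L · g + C'` with
`g = ρ_{‖z^{n,0} − z^{n−1,0}‖}(z^{n,0})` (the paper's (3.19)), then the adaptive condition
`ρ_{‖z̄ − z^{n,0}‖}(z̄) ≤ β · g` HOLDS for `z̄ = T_{t₁} z^{n,0}` as soon as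
`2C(q + 2)(L g + C') ≤ β g t₁` (Property 3 (a), Property 3 (b), the slack bound).
[cite: XiongFreund2024, Theorem 3.5 (proof, (3.21)–(3.24))] -/
theorem adaptive_condition_of_slack {ρ : ℝ → Z → ℝ} {Zstar : Set Z} {T : ℕ → Z → Z}
    {C q β L C' : ℝ} (hT : ∀ t : ℕ, 1 ≤ t → RestartProperty ρ Zstar (T t) C q t) (hC : 0 ≤ C)
    (hq : 0 ≤ q + 2) {zprev zn : Z}
    (hslack : infDist zn Zstar ≤ L * ρ (dist zn zprev) zn + C') {t₁ : ℕ} (ht₁ : 1 ≤ t₁)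
    (ht : 2 * C * (q + 2) * (L * ρ (dist zn zprev) zn + C') ≤ β * ρ (dist zn zprev) zn * t₁) :
    ρ (dist (T t₁ zn) zn) (T t₁ zn) ≤ β * ρ (dist zn zprev) zn := by
  have ht₁' : (0 : ℝ) < t₁ := Nat.cast_pos.mpr ht₁
  set g := ρ (dist zn zprev) zn with hg
  have h1 : ρ (dist (T t₁ zn) zn) (T t₁ zn) ≤ 2 * C * dist (T t₁ zn) zn / t₁ := (hT t₁ ht₁).gap_le zn
  have h2 : dist (T t₁ zn) zn ≤ (q + 2) * (L * g + C') :=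
    ((hT t₁ ht₁).dist_le zn).trans (mul_le_mul_of_nonneg_left hslack hq)
  have h3 : 2 * C * dist (T t₁ zn) zn / t₁ ≤ 2 * C * ((q + 2) * (L * g + C')) / t₁ :=
    div_le_div_of_nonneg_right (mul_le_mul_of_nonneg_left h2 (by positivity)) ht₁'.le
  have h4 : 2 * C * ((q + 2) * (L * g + C')) / t₁ ≤ β * g := by
    rw [div_le_iff₀ ht₁']
    calc 2 * C * ((q + 2) * (L * g + C')) = 2 * C * (q + 2) * (L * g + C') := by ring
      _ ≤ β * g * t₁ := ht
  exact h1.trans (h3.trans h4)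

/-- **Inner-loop length under sharpness with slack** [XiongFreund2024, Theorem 3.5 (proof, (3.24))]:
with first-hit adaptive restarts (the restart from `z^{n,0}` happens at the FIRST inner length
`τ_n ≥ 1` meeting the adaptive condition), `τ_n ≤ t₁` for every `t₁ ≥ 1` with
`2C(q + 2)(L g + C') ≤ β g t₁`; in particular `τ_n ≤ ⌊2C(q+2)(L + C'/g)/β⌋ + 1` when `g > 0`
(`sum_adaptive_lengths_le_of_slack`). [cite: XiongFreund2024, Theorem 3.5 (proof, (3.24))] -/
theorem adaptive_length_le_of_slack {ρ : ℝ → Z → ℝ} {Zstar : Set Z} {T : ℕ → Z → Z}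
    {C q β L C' : ℝ} (hT : ∀ t : ℕ, 1 ≤ t → RestartProperty ρ Zstar (T t) C q t) (hC : 0 ≤ C)
    (hq : 0 ≤ q + 2) {zprev zn : Z}
    (hslack : infDist zn Zstar ≤ L * ρ (dist zn zprev) zn + C') {τn : ℕ}
    (hfirst : ∀ t : ℕ, 1 ≤ t → t < τn →
      ¬ ρ (dist (T t zn) zn) (T t zn) ≤ β * ρ (dist zn zprev) zn)
    {t₁ : ℕ} (ht₁ : 1 ≤ t₁)
    (ht : 2 * C * (q + 2) * (L * ρ (dist zn zprev) zn + C') ≤ β * ρ (dist zn zprev) zn * t₁) :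
    τn ≤ t₁ := by
  by_contra hlt
  push Not at hlt
  exact hfirst t₁ ht₁ hlt (adaptive_condition_of_slack hT hC hq hslack ht₁ ht)

/-- The first potential is controlled by Property 3 at `z^{0,0}`:
`ρ_{‖z^{1,0} − z^{0,0}‖}(z^{1,0}) ≤ 2C(q+2)/τ₀ · dist(z^{0,0}, Z*)`.
[cite: XiongFreund2024, Theorem 3.5 (proof, (3.26) with n = 1)]
[cite: ApplegateEtAl2022, Theorem 2 (proof)] -/
theorem first_potential_le {ρ : ℝ → Z → ℝ} {Zstar : Set Z} {T : ℕ → Z → Z} {C q : ℝ}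
    (hT : ∀ t : ℕ, 1 ≤ t → RestartProperty ρ Zstar (T t) C q t) (hC : 0 ≤ C)
    {z : ℕ → Z} {τ : ℕ → ℕ} (hτ : ∀ n, 1 ≤ τ n) (hz : ∀ n, z (n + 1) = T (τ n) (z n)) :
    ρ (dist (z 1) (z 0)) (z 1) ≤ 2 * C * (q + 2) / τ 0 * infDist (z 0) Zstar := by
  have hτ0 : (0 : ℝ) < τ 0 := Nat.cast_pos.mpr (hτ 0)
  have h1 : ρ (dist (z 1) (z 0)) (z 1) ≤ 2 * C * dist (z 1) (z 0) / τ 0 := by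
    have h := (hT (τ 0) (hτ 0)).gap_le (z 0)
    rw [← hz 0] at h
    exact h
  have h2 : dist (z 1) (z 0) ≤ (q + 2) * infDist (z 0) Zstar := by
    have h := (hT (τ 0) (hτ 0)).dist_le (z 0)
    rw [← hz 0] at h
    exact h
  calc ρ (dist (z 1) (z 0)) (z 1) ≤ 2 * C * dist (z 1) (z 0) / τ 0 := h1
    _ ≤ 2 * C * ((q + 2) * infDist (z 0) Zstar) / τ 0 :=
        div_le_div_of_nonneg_right (mul_le_mul_of_nonneg_left h2 (by positivity)) hτ0.le
    _ = 2 * C * (q + 2) / τ 0 * infDist (z 0) Zstar := by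
        field_simp

/-- **[XiongFreund2024, Theorem 3.5] — iteration complexity of adaptively restarted primal–dual
methods under sharpness WITH SLACK**, abstract over [ApplegateEtAl2022, Property 3] (the paper states
it for restarted PDHG, Algorithm 2, whose Property-3 constants are Lemma 2.4; the proof uses nothing
else). Let `z^{n+1,0} = T_{τ_n} z^{n,0}` be produced by FIRST-HIT adaptive restarts with parameter
`β ∈ (0, 1)` (restart condition `g_{n+1} ≤ β g_n` for the potentials
`g_n = ρ_{‖z^{n+1,0} − z^{n,0}‖}(z^{n+1,0})`, each restart at the first inner length meeting it), and
suppose the relaxed sharpness hypothesis (3.19): `dist(z^{n,0}, Z*) ≤ L · g_{n−1} + C'` at every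
restart point (`L, C' ≥ 0`). If the potentials `g_0, …, g_{N−2}` all exceed `ε > 0` (i.e. the scheme
has not produced a potential `≤ ε` before restart `N`), then the total number of inner iterations
spent up to restart `N ≥ 1` obeys
`Σ_{n<N} τ_n ≤ τ_0 + (N − 1)(1 + 2C(q+2)L/β) + 2C(q+2)C'/(β ε (1 − β))`
— the paper's (3.30) `T ≤ (1 + 8L/β) N − 8L/β + 8C/(β(1−β)ε)` with `2C(q+2)` for its `8` and a free
first length `τ_0` (the paper restarts after one step, `k_0 = 1`); combined with the restart count
`(N − 2) log(1/β) < log(2C(q+2) dist(z^{0,0}, Z*)/(τ_0 ε))` (`restart_count_lt_of_potentials_gt`)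
this is
(3.20): `T = O(L log(dist(z^{0,0}, Z*)/ε) + C'/ε)`.
[cite: XiongFreund2024, Theorem 3.5] -/
theorem sum_adaptive_lengths_le_of_slack {ρ : ℝ → Z → ℝ} {Zstar : Set Z} {T : ℕ → Z → Z}
    {C q β L C' ε : ℝ} (hT : ∀ t : ℕ, 1 ≤ t → RestartProperty ρ Zstar (T t) C q t) (hC : 0 ≤ C)
    (hq : 0 ≤ q + 2) (hβ0 : 0 < β) (hβ1 : β < 1) (hL : 0 ≤ L) (hC' : 0 ≤ C') (hε : 0 < ε)
    {z : ℕ → Z} {τ : ℕ → ℕ}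
    (hcond : ∀ n, ρ (dist (z (n + 2)) (z (n + 1))) (z (n + 2)) ≤
      β * ρ (dist (z (n + 1)) (z n)) (z (n + 1)))
    (hfirst : ∀ n t : ℕ, 1 ≤ t → t < τ (n + 1) →
      ¬ ρ (dist (T t (z (n + 1))) (z (n + 1))) (T t (z (n + 1))) ≤
        β * ρ (dist (z (n + 1)) (z n)) (z (n + 1)))
    (hslack : ∀ n, infDist (z (n + 1)) Zstar ≤ L * ρ (dist (z (n + 1)) (z n)) (z (n + 1)) + C')
    {N : ℕ} (hN : 1 ≤ N) (hpot : ∀ k, k + 2 ≤ N → ε < ρ (dist (z (k + 1)) (z k)) (z (k + 1))) :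
    (∑ n ∈ Finset.range N, (τ n : ℝ)) ≤
      τ 0 + ((N : ℝ) - 1) * (1 + 2 * C * (q + 2) * L / β) +
        2 * C * (q + 2) * C' / β * (ε * (1 - β))⁻¹ := by
  set g : ℕ → ℝ := fun k => ρ (dist (z (k + 1)) (z k)) (z (k + 1)) with hg
  set P : ℝ := 2 * C * (q + 2) with hP
  have hP0 : 0 ≤ P := by positivity
  have hcond' : ∀ n, g (n + 1) ≤ β * g n := fun n => hcond n
  -- the per-restart inner-length bound (3.24)
  have hlen : ∀ k, k + 2 ≤ N → (τ (k + 1) : ℝ) ≤ 1 + P * L / β + P * C' / β * (g k)⁻¹ := by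
    intro k hk
    have hgk : 0 < g k := hε.trans (hpot k hk)
    set x : ℝ := P * (L * g k + C') / (β * g k) with hx
    have hx0 : 0 ≤ x := by positivity
    set t₁ : ℕ := ⌊x⌋₊ + 1 with ht₁
    have ht₁1 : 1 ≤ t₁ := Nat.le_add_left 1 _
    have hxt : x < t₁ := by rw [ht₁]; push_cast; exact Nat.lt_floor_add_one x
    have hineq : P * (L * g k + C') ≤ β * g k * t₁ := by
      have hβg : 0 < β * g k := mul_pos hβ0 hgk
      have := (div_lt_iff₀ hβg).mp hxt
      linarith
    have hτle : τ (k + 1) ≤ t₁ :=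
      adaptive_length_le_of_slack hT hC hq (hslack k) (hfirst k) ht₁1 (by rw [hP] at hineq; exact hineq)
    have hτle' : (τ (k + 1) : ℝ) ≤ t₁ := by exact_mod_cast hτle
    have ht₁le : (t₁ : ℝ) ≤ x + 1 := by
      rw [ht₁]; push_cast; linarith [Nat.floor_le hx0]
    have hxe : x = P * L / β + P * C' / β * (g k)⁻¹ := by
      rw [hx]; field_simp
    linarith [hτle', ht₁le, hxe]
  have h := sum_lengths_le hβ0.le hβ1 hε (by positivity : 0 ≤ P * C' / β) hcond' hN hpot hlen
  simpa [hP] using h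

/-- **The number of restarts before convergence** [XiongFreund2024, Theorem 3.5 (proof,
(3.26)–(3.27))]: if the potentials `g_0, …, g_{N−2}` all exceed `ε` then
`ε < β^{N−2} · (2C(q+2)/τ_0) · dist(z^{0,0}, Z*)` (geometric decay from the first potential).
[cite: XiongFreund2024, Theorem 3.5 (proof, (3.26)–(3.27))] -/
theorem lt_pow_mul_of_potentials_gt {ρ : ℝ → Z → ℝ} {Zstar : Set Z} {T : ℕ → Z → Z}
    {C q β ε : ℝ} (hT : ∀ t : ℕ, 1 ≤ t → RestartProperty ρ Zstar (T t) C q t) (hC : 0 ≤ C)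
    (hβ0 : 0 ≤ β) {z : ℕ → Z} {τ : ℕ → ℕ} (hτ : ∀ n, 1 ≤ τ n)
    (hz : ∀ n, z (n + 1) = T (τ n) (z n))
    (hcond : ∀ n, ρ (dist (z (n + 2)) (z (n + 1))) (z (n + 2)) ≤
      β * ρ (dist (z (n + 1)) (z n)) (z (n + 1)))
    {N : ℕ} (hN : 2 ≤ N) (hpot : ∀ k, k + 2 ≤ N → ε < ρ (dist (z (k + 1)) (z k)) (z (k + 1))) :
    ε < β ^ (N - 2) * (2 * C * (q + 2) / τ 0 * infDist (z 0) Zstar) := by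
  set g : ℕ → ℝ := fun k => ρ (dist (z (k + 1)) (z k)) (z (k + 1)) with hg
  have hcond' : ∀ n, g (n + 1) ≤ β * g n := fun n => hcond n
  have h1 : ε < g (N - 2) := hpot (N - 2) (by omega)
  have h2 : g (N - 2) ≤ β ^ (N - 2) * g 0 := by
    have h := potential_add_le_pow_mul hβ0 hcond' 0 (N - 2)
    rwa [zero_add] at h
  have h3 : g 0 ≤ 2 * C * (q + 2) / τ 0 * infDist (z 0) Zstar := first_potential_le hT hC hτ hz
  exact h1.trans_le (h2.trans (mul_le_mul_of_nonneg_left h3 (pow_nonneg hβ0 _)))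

/-- The logarithmic form of the restart count [XiongFreund2024, Theorem 3.5 (proof, (3.27))]:
`(N − 2) · log(1/β) < log(2C(q+2) dist(z^{0,0}, Z*)/(τ_0 ε))` whenever `g_0, …, g_{N−2} > ε`
(`0 < β < 1`, `N ≥ 2`). [cite: XiongFreund2024, Theorem 3.5 (proof, (3.27))] -/
theorem restart_count_lt_of_potentials_gt {ρ : ℝ → Z → ℝ} {Zstar : Set Z} {T : ℕ → Z → Z}
    {C q β ε : ℝ} (hT : ∀ t : ℕ, 1 ≤ t → RestartProperty ρ Zstar (T t) C q t) (hC : 0 ≤ C)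
    (hβ0 : 0 < β) (hε : 0 < ε) {z : ℕ → Z} {τ : ℕ → ℕ} (hτ : ∀ n, 1 ≤ τ n)
    (hz : ∀ n, z (n + 1) = T (τ n) (z n))
    (hcond : ∀ n, ρ (dist (z (n + 2)) (z (n + 1))) (z (n + 2)) ≤
      β * ρ (dist (z (n + 1)) (z n)) (z (n + 1)))
    {N : ℕ} (hN : 2 ≤ N) (hpot : ∀ k, k + 2 ≤ N → ε < ρ (dist (z (k + 1)) (z k)) (z (k + 1))) :
    ((N : ℝ) - 2) * Real.log (1 / β) <
      Real.log (2 * C * (q + 2) / τ 0 * infDist (z 0) Zstar / ε) := by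
  set A : ℝ := 2 * C * (q + 2) / τ 0 * infDist (z 0) Zstar with hA
  have h := lt_pow_mul_of_potentials_gt hT hC hβ0.le hτ hz hcond hN hpot
  rw [← hA] at h
  have hβN : 0 < β ^ (N - 2) := pow_pos hβ0 _
  have hApos : 0 < A := by
    by_contra hle
    push Not at hle
    have : β ^ (N - 2) * A ≤ 0 := mul_nonpos_of_nonneg_of_nonpos hβN.le hle
    linarith
  -- `ε < β^(N-2) A` ⇒ `log ε < (N-2) log β + log A`
  have hlog := Real.log_lt_log hε h
  rw [Real.log_mul hβN.ne' hApos.ne', Real.log_pow] at hlog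
  have hN2 : ((N - 2 : ℕ) : ℝ) = (N : ℝ) - 2 := by
    rw [Nat.cast_sub hN]; push_cast; ring
  rw [hN2] at hlog
  rw [one_div, Real.log_inv, Real.log_div hApos.ne' hε.ne']
  linarith

end Literature.Analysis.Convex.PrimalDualRestartSharpness
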